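import Summits.QuantumFields.BalabanUV.Beta.MultiscaleHessianCutoff
import Summits.QuantumFields.BalabanUV.Beta.MultiscaleBoxDistance
import Summits.QuantumFields.BalabanUV.Beta.MultiscaleGlobalMember
import Summits.QuantumFields.BalabanUV.Beta.MultiscaleAveragingPointwise

/-!
# `Summit.QuantumFields.BalabanUV.Beta.MultiscaleHessianGeometry` — engine file 22d: THE GEOMETRY OF THE LOCALISER — the middle point
# `x₀` of a cell `k` of side `S` (the cell sits in the coordinate box `dist(·,x₀) ≤ S/2`), the box `dist(·,x₀) ≤ 8S` inside the
# scale-adapted ball `d_n(·,x₀) ≤ ρ₀` under ONE rate-type hypothesis `8·d·L^A·e^{(log L/R)ρ₀} ≤ ρ₀` (file 16a), hence inside the union of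
# the cells `k″` with `d_n(t_{k″},t_k) ≤ 4d + ρ₀` — whose scales are within `L^A e^{(log L/R)(4d+ρ₀)}` of `S`, whose number is bounded by
# the growth clause, and on which box sums are dominated by cell sums (programme «HESSIAN-L2-FLAT», files 22a–22f)

HONEST FRAMING (page 1 of everything in this cell).  Discharging `FlowStep.BetaPertH` would make Bałaban's ultraviolet
stability UNCONDITIONAL — a constructive-QFT result; it is NOT the continuum limit and NOT the Clay problem.  This module
discharges nothing of `BetaPertH`; it is [folklore] lattice bookkeeping, kernel-checked, by the OWNER of binder row D4 (unit
`b2b-balaban-beta-an4`, gen 47).  HONEST DEPENDENCY: continuum YM on T⁴ ⇐ BetaPertH ∧ nine spine estimates (0/9 proved); BetaPertH ⇐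
(D1) ∧ (D4) ∧ CAP+tail; G-an2-4 gates asym, D1 and NE2/3/4.

THE POINT.  File 22c controls the Hessian energy of `w` on cell `k` by `D*Dw`, `w`, `Dw` on a coordinate box of radius `≈ 3S` around the
cell (the C² cutoff of file 22b with inner radius `S/2 + 2` and width `S`).  To feed the CELLWISE members (3.46)₁ (file 8), (3.46)₂
(file 20c) and the averaging budget (file 10a), that box must be covered by cells of comparable scale at bounded `d_n`-distance, and
their number bounded: this file.  `cellMid k` is the cube point with all offsets `⌊S/2⌋`; every point of cell `k` is within sup-distance
`⌊S/2⌋` of it (`dist_le_of_cellOf_eq`, coordinates `cubePt_val` + `circAbs_le_abs` + 22b's `dist_le_of_cdist_le`).  beta-d4-p2∕owner's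
16a `sdist_le_of_dist_le` puts the box `dist(·,x₀) ≤ r` (`r ≤ 8S`) inside `d_n(·,x₀) ≤ ρ₀` as soon as `8dΓ ≤ ρ₀`, `Γ = L^A e^{(log L/R)ρ₀}`
(`sdist_le_of_box`); the corner thresholds then give `d_n(t_{k(y)}, t_k) ≤ 4d + ρ₀` (`sdist_centres_le_of_box`), the additive datum at
the centres gives the two-sided scale comparison (`scale_cmp_of_near`), beta-d4-p3's `cell_growth_add` counts the cells
(`card_near_le`), the triangle inequality transfers the decay from `t_{k″}` to `t_k` (`exp_decay_transfer`), and
`Finset.sum_fiberwise_of_maps_to` dominates box sums by sums over the near cells (`sum_box_le_sum_cells_site`, `sum_box_le_sum_cells_bond`).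

WHAT IS CERTIFIED (kernel, 0 sorry; one `def`: `cellMid`).  LOCATORS (shape only; ABSOLUTE RULE — nothing printed is asserted):
[Balaban1984PropagatorsII] (2.1)–(2.2) p. 224, (2.46) p. 231, Lemma 2.1 (2.61) p. 234; [Balaban1985BackgroundPropagators] Thm 3.1
(3.46) p. 398.  Row D4: NO class change (critical-path width 0; D4 DISCHARGE NO DATE); NOT BetaPertH, NOT continuum, NOT Clay, NOT summit
progress.
-/

open scoped BigOperators
open Finset

namespace Summit.QuantumFields.BalabanUV.Beta.MultiscaleHessianGeometry

open Summit.QuantumFields.BalabanUV.Beta.MultiscaleHessianCutoff (dist_le_of_cdist_le)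
open Summit.QuantumFields.BalabanUV.Beta.MultiscaleBoxDistance (sdist_le_of_dist_le)
open Summit.QuantumFields.BalabanUV.Beta.MultiscaleCombesThomasL2CellsGraded (siteScale_ctrU)
open Summit.QuantumFields.BalabanUV.Beta.MultiscaleGrowthCells (cell_growth_add)
open Summit.QuantumFields.BalabanUV.Beta.MultiscaleAveragingPointwise (sum_cellCp_eq)
open Summit.QuantumFields.BalabanUV.Beta.BoxPoincare (Box)
open Summit.QuantumFields.BalabanUV.Beta.MultiscaleCoerciveTorus
open Summit.QuantumFields.BalabanUV.Beta.MultiscaleDistance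
open Summit.QuantumFields.BalabanUV.Beta.MultiscaleDistanceGraded (scale_le_scale_mul_exp_add)
open Summit.QuantumFields.BalabanUV.Beta.MultiscaleDistanceMetric (sdist_comm sdist_triangle_torus)
open Summit.QuantumFields.BalabanUV.Beta.MultiscaleDecayBudget
open Summit.QuantumFields.BalabanUV.Beta.AccretiveCombesThomasSandwichSite (sdist_corner_thresholds)
open Literature.MathematicalPhysics.QuantumFieldTheory.Balaban1983to89
open Literature.MathematicalPhysics.QuantumFieldTheory.Balaban1983to89.B9Thm37GluePU (bsrc btgt bsrc_apply)
open B4TorusKernel.MultiPeriod (circAbs circAbs_le_abs)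
open B5TorusCover (UT Ctr ctrU)

noncomputable section

variable {d : ℕ} {N : Fin d → ℕ} [∀ i, NeZero (N i)] [NeZero d] {J K : Type} [Fintype K] [DecidableEq K]
  (S : J → ℕ) (hS : ∀ l, 1 ≤ S l) (hdivS : ∀ l i, S l ∣ N i) (lvl : K → J) (zc : (k : K) → Ctr N (S (lvl k)))
  (hdisj : ∀ k k' v v', cellPt S hS hdivS lvl zc k v = cellPt S hS hdivS lvl zc k' v' → k = k')
  (hcover : ∀ x : UT N, ∃ k, ∃ v : Box d (S (lvl k)), cellPt S hS hdivS lvl zc k v = x)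

/-! ## §1 The middle point of a cell -/

/-- The MIDDLE POINT of cell `k`: the cube point with all offsets `⌊S_{l_k}/2⌋`. [folklore] -/
def cellMid (k : K) : UT N :=
  cellPt S hS hdivS lvl zc k fun _ => ⟨S (lvl k) / 2, Nat.div_lt_of_lt_mul (by have := hS (lvl k); omega)⟩

include hdisj in
omit [NeZero d] [Fintype K] [DecidableEq K] in
/-- The middle point lies in its cell. [folklore] -/
theorem cellOf_cellMid (k : K) : cellOf S hS hdivS lvl zc hcover (cellMid S hS hdivS lvl zc k) = k :=
  cellOf_cellPt S hS hdivS lvl zc hdisj hcover k _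

include hdisj in
omit [NeZero d] [Fintype K] [DecidableEq K] in
/-- The scale at the middle point is the cell's side. [folklore] -/
theorem siteScale_cellMid (k : K) : siteScale S hS hdivS lvl zc hcover (cellMid S hS hdivS lvl zc k) = S (lvl k) := by
  rw [siteScale, cellOf_cellMid S hS hdivS lvl zc hdisj hcover]

omit [NeZero d] [Fintype K] [DecidableEq K] in
/-- Every chart point of cell `k` is within sup-distance `⌊S/2⌋` of the middle point (coordinates). [folklore] -/
theorem dist_cellPt_cellMid_le (k : K) (v : Box d (S (lvl k))) :
    dist (cellPt S hS hdivS lvl zc k v) (cellMid S hS hdivS lvl zc k) ≤ ((S (lvl k) / 2 : ℕ) : ℝ) := by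
  refine dist_le_of_cdist_le fun ν => ?_
  have e1 : ((UT.toSite N (cellPt S hS hdivS lvl zc k v) ν).val : ℤ) = (v ν : ℕ) + (S (lvl k) : ℤ) * ((zc k ν : ℕ) : ℤ) := by
    rw [cellPt, cubePt_val]; push_cast; ring
  have e2 : ((UT.toSite N (cellMid S hS hdivS lvl zc k) ν).val : ℤ) = (S (lvl k) / 2 : ℕ) + (S (lvl k) : ℤ) * ((zc k ν : ℕ) : ℤ) := by
    rw [cellMid, cellPt, cubePt_val]; push_cast; ring
  rw [e1, e2]
  refine (circAbs_le_abs (UT.one_le N ν) _).trans ?_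
  have hv1 := (v ν).2
  rw [abs_le]; constructor <;> omega

omit [NeZero d] [Fintype K] [DecidableEq K] in
/-- **Every point of cell `k` is within sup-distance `⌊S/2⌋` of the middle point.** [folklore] -/
theorem dist_le_of_cellOf_eq (k : K) {x : UT N} (hx : cellOf S hS hdivS lvl zc hcover x = k) :
    dist x (cellMid S hS hdivS lvl zc k) ≤ ((S (lvl k) / 2 : ℕ) : ℝ) := by
  subst hx
  obtain ⟨v, hv⟩ := cellOf_spec S hS hdivS lvl zc hcover x
  have key := dist_cellPt_cellMid_le S hS hdivS lvl zc (cellOf S hS hdivS lvl zc hcover x) v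
  rwa [hv] at key

/-! ## §2 The box around the middle point sits in the scale-adapted ball (file 16a) -/

section Graded

variable {L : ℕ} (hL : 1 ≤ L) (e : J → ℕ) (hSe : ∀ l, S l = L ^ e l) {R : ℝ} (hR : 0 < R) {A : ℕ}
  (hadd : ∀ x y : UT N, |(e (lvl (cellOf S hS hdivS lvl zc hcover x)) : ℝ) - e (lvl (cellOf S hS hdivS lvl zc hcover y))| ≤
    A + sdist bsrc btgt (siteScale S hS hdivS lvl zc hcover) x y / R)

include hdisj hL hSe hR hadd

omit [NeZero d] [Fintype K] [DecidableEq K] in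
/-- **The box `dist(·,x₀) ≤ r` with `r ≤ 8S` lies in `d_n(·,x₀) ≤ ρ₀`** (`x₀` the middle point of a cell of side `S`) as soon as
`8·d·L^A·e^{(log L/R)ρ₀} ≤ ρ₀` — file 16a's `sdist_le_of_dist_le`. [cite: Balaban1984PropagatorsII, (2.46) p.231] [folklore] -/
theorem sdist_le_of_box (k : K) {ρ₀ : ℕ} (hρ₀ : 8 * d * ((L : ℝ) ^ A * Real.exp (Real.log L / R * ρ₀)) ≤ ρ₀) {r : ℕ}
    (hr : r ≤ 8 * S (lvl k)) {y : UT N} (hy : dist y (cellMid S hS hdivS lvl zc k) ≤ r) :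
    sdist bsrc btgt (siteScale S hS hdivS lvl zc hcover) y (cellMid S hS hdivS lvl zc k) ≤ ρ₀ := by
  have hn1 : ∀ x, 1 ≤ siteScale S hS hdivS lvl zc hcover x := one_le_siteScale S hS hdivS lvl zc hcover
  have hgr : ∀ x, siteScale S hS hdivS lvl zc hcover x = L ^ (e (lvl (cellOf S hS hdivS lvl zc hcover x))) := fun x => by
    rw [siteScale, hSe]
  have hS0 : (0 : ℝ) < S (lvl k) := by exact_mod_cast hS (lvl k)
  have hΓ0 : 0 ≤ (L : ℝ) ^ A * Real.exp (Real.log L / R * ρ₀) := by positivity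
  have hmid := siteScale_cellMid S hS hdivS lvl zc hdisj hcover k
  have hbudget : ((d * r : ℕ) : ℝ) * ((L : ℝ) ^ A * Real.exp (Real.log L / R * ρ₀)) /
      (siteScale S hS hdivS lvl zc hcover (cellMid S hS hdivS lvl zc k)) ≤ ρ₀ := by
    rw [hmid, div_le_iff₀ hS0]
    have h1 : ((d * r : ℕ) : ℝ) ≤ 8 * d * S (lvl k) := by
      have : d * r ≤ 8 * d * S (lvl k) := by nlinarith
      exact_mod_cast this
    calc ((d * r : ℕ) : ℝ) * ((L : ℝ) ^ A * Real.exp (Real.log L / R * ρ₀))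
        ≤ (8 * d * S (lvl k)) * ((L : ℝ) ^ A * Real.exp (Real.log L / R * ρ₀)) := mul_le_mul_of_nonneg_right h1 hΓ0
      _ = (8 * d * ((L : ℝ) ^ A * Real.exp (Real.log L / R * ρ₀))) * S (lvl k) := by ring
      _ ≤ ρ₀ * S (lvl k) := mul_le_mul_of_nonneg_right hρ₀ hS0.le
  have h := sdist_le_of_dist_le (siteScale S hS hdivS lvl zc hcover) hn1 hL (fun x => e (lvl (cellOf S hS hdivS lvl zc hcover x)))
    hgr hR (cellMid S hS hdivS lvl zc k) (fun y => hadd y _) r hbudget hy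
  exact h.trans hbudget

omit [Fintype K] [DecidableEq K] in
/-- **Cells meeting the box are near**: `dist(y,x₀) ≤ r ≤ 8S` ⟹ `d_n(t_{k(y)}, t_k) ≤ 4d + ρ₀` (corner thresholds at both ends).
[folklore] -/
theorem sdist_centres_le_of_box (k : K) {ρ₀ : ℕ} (hρ₀ : 8 * d * ((L : ℝ) ^ A * Real.exp (Real.log L / R * ρ₀)) ≤ ρ₀) {r : ℕ}
    (hr : r ≤ 8 * S (lvl k)) {y : UT N} (hy : dist y (cellMid S hS hdivS lvl zc k) ≤ r) :
    sdist bsrc btgt (siteScale S hS hdivS lvl zc hcover)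
        (ctrU N (S (lvl (cellOf S hS hdivS lvl zc hcover y))) (zc (cellOf S hS hdivS lvl zc hcover y))) (ctrU N (S (lvl k)) (zc k)) ≤
      4 * d + ρ₀ := by
  set n := siteScale S hS hdivS lvl zc hcover with hn
  have h1 := sdist_le_of_box S hS hdivS lvl zc hdisj hcover hL e hSe hR hadd k hρ₀ hr hy
  have h2 := (sdist_corner_thresholds S hS hdivS lvl zc hdisj hcover (cellMid S hS hdivS lvl zc k) k).1
    (cellOf_cellMid S hS hdivS lvl zc hdisj hcover k)
  have h3 := (sdist_corner_thresholds S hS hdivS lvl zc hdisj hcover y (cellOf S hS hdivS lvl zc hcover y)).1 rfl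
  have t1 := sdist_triangle_torus n (ctrU N (S (lvl (cellOf S hS hdivS lvl zc hcover y))) (zc (cellOf S hS hdivS lvl zc hcover y)))
    y (ctrU N (S (lvl k)) (zc k))
  have t2 := sdist_triangle_torus n y (cellMid S hS hdivS lvl zc k) (ctrU N (S (lvl k)) (zc k))
  rw [sdist_comm bsrc btgt n _ y] at t1
  rw [← hn] at h1 h2 h3
  linarith

omit [NeZero d] [Fintype K] [DecidableEq K] in
/-- **Two-sided scale comparison for near cells**: `d_n(t_{k″},t_k) ≤ D` ⟹ `S_{k″} ≤ L^A e^{(log L/R)D}·S_k` and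
`S_k ≤ L^A e^{(log L/R)D}·S_{k″}` (the additive datum at the pair of centres). [cite: Balaban1984PropagatorsII, (2.1)-(2.2) p.224] [folklore] -/
theorem scale_cmp_of_near (k k'' : K) {D : ℝ}
    (hD : sdist bsrc btgt (siteScale S hS hdivS lvl zc hcover) (ctrU N (S (lvl k'')) (zc k'')) (ctrU N (S (lvl k)) (zc k)) ≤ D) :
    (S (lvl k'') : ℝ) ≤ (L : ℝ) ^ A * Real.exp (Real.log L / R * D) * S (lvl k) ∧
      (S (lvl k) : ℝ) ≤ (L : ℝ) ^ A * Real.exp (Real.log L / R * D) * S (lvl k'') := by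
  set n := siteScale S hS hdivS lvl zc hcover with hn
  have hgr : ∀ x, n x = L ^ (e (lvl (cellOf S hS hdivS lvl zc hcover x))) := fun x => by rw [hn, siteScale, hSe]
  have hk : ∀ k₁ : K, (n (ctrU N (S (lvl k₁)) (zc k₁)) : ℝ) = S (lvl k₁) := fun k₁ => by
    rw [hn, siteScale_ctrU S hS hdivS lvl zc hdisj hcover k₁]
  have hL1 : (1 : ℝ) ≤ L := by exact_mod_cast hL
  have ht : 0 ≤ Real.log L / R := div_nonneg (Real.log_nonneg hL1) hR.le
  have hexp : ∀ {D' : ℝ}, D' ≤ D → Real.exp (Real.log L / R * D') ≤ Real.exp (Real.log L / R * D) := fun h =>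
    Real.exp_le_exp.mpr (mul_le_mul_of_nonneg_left h ht)
  have h1 := scale_le_scale_mul_exp_add bsrc btgt n hL (fun y => e (lvl (cellOf S hS hdivS lvl zc hcover y))) hgr (A := A)
    (hadd (ctrU N (S (lvl k)) (zc k)) (ctrU N (S (lvl k'')) (zc k'')))
  have h2 := scale_le_scale_mul_exp_add bsrc btgt n hL (fun y => e (lvl (cellOf S hS hdivS lvl zc hcover y))) hgr (A := A)
    (hadd (ctrU N (S (lvl k'')) (zc k'')) (ctrU N (S (lvl k)) (zc k)))
  rw [hk, hk, sdist_comm bsrc btgt n] at h1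
  rw [hk, hk] at h2
  have hS1 : (0 : ℝ) ≤ S (lvl k) := Nat.cast_nonneg _
  have hS2 : (0 : ℝ) ≤ S (lvl k'') := Nat.cast_nonneg _
  have hLA : (0 : ℝ) ≤ (L : ℝ) ^ A := by positivity
  constructor
  · calc (S (lvl k'') : ℝ) ≤ (L : ℝ) ^ A * S (lvl k) * Real.exp (Real.log L / R * sdist bsrc btgt n (ctrU N (S (lvl k'')) (zc k''))
          (ctrU N (S (lvl k)) (zc k))) := h1
      _ ≤ (L : ℝ) ^ A * S (lvl k) * Real.exp (Real.log L / R * D) := mul_le_mul_of_nonneg_left (hexp hD) (mul_nonneg hLA hS1)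
      _ = _ := by ring
  · calc (S (lvl k) : ℝ) ≤ (L : ℝ) ^ A * S (lvl k'') * Real.exp (Real.log L / R * sdist bsrc btgt n (ctrU N (S (lvl k'')) (zc k''))
          (ctrU N (S (lvl k)) (zc k))) := h2
      _ ≤ (L : ℝ) ^ A * S (lvl k'') * Real.exp (Real.log L / R * D) := mul_le_mul_of_nonneg_left (hexp hD) (mul_nonneg hLA hS2)
      _ = _ := by ring

omit [DecidableEq K] in
/-- **The number of near cells** `#{k″ : d_n(t_{k″},t_k) ≤ 4d + ρ₀} ≤ N₀·Λ^{4d+ρ₀+1}` (beta-d4-p3's `cell_growth_add`, free `ε > 0`).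
[cite: Balaban1984PropagatorsII, Lemma 2.1 (2.61) p.234] [folklore] -/
theorem card_near_le (k : K) (ρ₀ : ℕ) {ε : ℝ} (hε : 0 < ε) :
    ((univ.filter fun k'' : K => sdist bsrc btgt (siteScale S hS hdivS lvl zc hcover)
        (ctrU N (S (lvl k'')) (zc k'')) (ctrU N (S (lvl k)) (zc k)) ≤ 4 * d + ρ₀).card : ℝ) ≤
      (3 * ((L : ℝ) ^ A) ^ 2) ^ d * ((d.factorial : ℝ) / ε ^ d) * Real.exp (2 * d * (ε + Real.log L / R * d)) *
        Real.exp (ε + 2 * (Real.log L / R) * d) ^ (4 * d + ρ₀ + 1) := by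
  classical
  have hgr : ∀ x, siteScale S hS hdivS lvl zc hcover x = L ^ (e (lvl (cellOf S hS hdivS lvl zc hcover x))) := fun x => by
    rw [siteScale, hSe]
  have h := cell_growth_add S hS hdivS lvl zc hdisj hcover hL (fun y => e (lvl (cellOf S hS hdivS lvl zc hcover y))) hgr hR (A := A)
    hadd hε k (4 * d + ρ₀ + 1)
  refine le_trans ?_ h
  have hsub : (univ.filter fun k'' : K => sdist bsrc btgt (siteScale S hS hdivS lvl zc hcover)
        (ctrU N (S (lvl k'')) (zc k'')) (ctrU N (S (lvl k)) (zc k)) ≤ 4 * d + ρ₀) ⊆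
      (univ.filter fun k'' : K => sdist bsrc btgt (siteScale S hS hdivS lvl zc hcover)
        (ctrU N (S (lvl k)) (zc k)) (ctrU N (S (lvl k'')) (zc k'')) < ((4 * d + ρ₀ + 1 : ℕ) : ℝ)) := by
    intro k'' hk''
    rw [mem_filter] at hk'' ⊢
    refine ⟨mem_univ _, ?_⟩
    rw [sdist_comm bsrc btgt]
    push_cast
    linarith [hk''.2]
  exact_mod_cast Finset.card_le_card hsub

end Graded

/-! ## §3 Decay transfer and box sums dominated by cell sums -/

omit [NeZero d] [Fintype K] [DecidableEq K] in
/-- **Decay transfer** along `d_n(t_k,t_{k′}) ≤ d_n(t_k,t_{k″}) + d_n(t_{k″},t_{k′})`: for `κ′ ≥ 0` and `d_n(t_{k″},t_k) ≤ D`,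
`e^{−κ′d_n(t_{k″},t_{k′})} ≤ e^{κ′D}·e^{−κ′d_n(t_k,t_{k′})}`. [folklore] -/
theorem exp_decay_transfer {κ' D : ℝ} (hκ' : 0 ≤ κ') (k k' k'' : K)
    (hD : sdist bsrc btgt (siteScale S hS hdivS lvl zc hcover) (ctrU N (S (lvl k'')) (zc k'')) (ctrU N (S (lvl k)) (zc k)) ≤ D) :
    Real.exp (-(κ' * sdist bsrc btgt (siteScale S hS hdivS lvl zc hcover) (ctrU N (S (lvl k'')) (zc k'')) (ctrU N (S (lvl k')) (zc k')))) ≤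
      Real.exp (κ' * D) *
        Real.exp (-(κ' * sdist bsrc btgt (siteScale S hS hdivS lvl zc hcover) (ctrU N (S (lvl k)) (zc k)) (ctrU N (S (lvl k')) (zc k')))) := by
  rw [← Real.exp_add]
  refine Real.exp_le_exp.mpr ?_
  have t := sdist_triangle_torus (siteScale S hS hdivS lvl zc hcover) (ctrU N (S (lvl k)) (zc k)) (ctrU N (S (lvl k'')) (zc k''))
    (ctrU N (S (lvl k')) (zc k'))
  rw [sdist_comm bsrc btgt _ (ctrU N (S (lvl k)) (zc k)) (ctrU N (S (lvl k'')) (zc k''))] at t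
  nlinarith

omit [NeZero d] [Fintype K] in
/-- **Box sums of site functions are dominated by sums over the cells in a target set** containing the cell of every box point.
[folklore] -/
theorem sum_box_le_sum_cells_site {Cp : Type} [Fintype Cp] (B : Finset (UT N)) (T : Finset K)
    (hBT : ∀ y ∈ B, cellOf S hS hdivS lvl zc hcover y ∈ T) (F : UT N × Cp → ℝ) (hF : ∀ p, 0 ≤ F p) :
    ∑ y ∈ B, ∑ i, F (y, i) ≤ ∑ k'' ∈ T, ∑ p ∈ univ.filter (fun p : UT N × Cp => cellOf S hS hdivS lvl zc hcover p.1 = k''), F p := by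
  classical
  rw [← Finset.sum_fiberwise_of_maps_to hBT]
  refine Finset.sum_le_sum fun k'' _ => ?_
  rw [sum_cellCp_eq S hS hdivS lvl zc hcover k'' F]
  exact Finset.sum_le_sum_of_subset_of_nonneg (fun y hy => by
    rw [mem_filter] at hy ⊢; exact ⟨mem_univ _, hy.2⟩) fun y _ _ => Finset.sum_nonneg fun i _ => hF _

omit [NeZero d] [Fintype K] in
/-- **Box sums of bond functions (bonds listed by their source) are dominated by sums over the cells in a target set.** [folklore] -/
theorem sum_box_le_sum_cells_bond {Cp : Type} [Fintype Cp] (B : Finset (UT N)) (T : Finset K)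
    (hBT : ∀ y ∈ B, cellOf S hS hdivS lvl zc hcover y ∈ T) (G : (UT N × Fin d) × Cp → ℝ) (hG : ∀ q, 0 ≤ G q) :
    ∑ y ∈ B, ∑ ν, ∑ i, G ((y, ν), i) ≤
      ∑ k'' ∈ T, ∑ b ∈ univ.filter (fun b : UT N × Fin d => cellOf S hS hdivS lvl zc hcover (bsrc b) = k''), ∑ i, G (b, i) := by
  classical
  rw [← Finset.sum_fiberwise_of_maps_to hBT]
  refine Finset.sum_le_sum fun k'' _ => ?_
  have heq : (univ.filter (fun b : UT N × Fin d => cellOf S hS hdivS lvl zc hcover (bsrc b) = k'')) =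
      (univ.filter (fun y : UT N => cellOf S hS hdivS lvl zc hcover y = k'')) ×ˢ (univ : Finset (Fin d)) := by
    ext b
    simp only [mem_filter, mem_univ, true_and, mem_product, and_true, bsrc]
  rw [heq, Finset.sum_product]
  exact Finset.sum_le_sum_of_subset_of_nonneg (fun y hy => by
    rw [mem_filter] at hy ⊢; exact ⟨mem_univ _, hy.2⟩) fun y _ _ => Finset.sum_nonneg fun ν _ => Finset.sum_nonneg fun i _ => hG _

end

end Summit.QuantumFields.BalabanUV.Beta.MultiscaleHessianGeometry
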